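import Literature.Analysis.OperatorTheory.YangMillsMatrixModelEnergyBilinear
import Literature.Analysis.OperatorTheory.YangMillsMatrixModelDiscreteness
import Literature.Analysis.FunctionSpaces.RellichConfiningPotential
import HarnessLib

/-!
# Lüscher's matrix model: the invariant `C²_c` core inside `L²(ℝ⁹)` — features, Green, Rellich

Topic `Literature/Analysis/OperatorTheory`; sibling of `YangMillsMatrixModelEnergyBilinear.lean` (bilinear form
`energyBilin`, Green's identity on the core, `coreSubmodule`) and of `YangMillsMatrixModelEigenfunctions.lean` (the named
fact AL1 `LuscherHamiltonianEigenfunctions`).  AL1's docstring splits it into (1) an `L²`-orthonormal eigenbasis of the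
Friedrichs operator of `𝔮` on the colour-invariant sector realising the min–max levels `physLevel` [Reed–Simon IV,
Thm XIII.64 + XIII.2], (2) elliptic regularity, (3) Agmon decay.  Item (1) is proved in
`YangMillsMatrixModelWeakEigenbasis.lean` from the generic tree theorems
`Literature.Analysis.UnboundedOperators.exists_core_form_eigenseq` (XIII.64 (iv)⇒(v) + XIII.2 on a form core) and
`Literature.Analysis.FunctionSpaces.totallyBounded_Lp_of_confining` (Rellich with a confining weight); this file supplies
the model-specific inputs, over `C²_c` test functions `ψ` (`IsTestFn ψ`):

* §1 `L²` bookkeeping: `ψ`, `√V·ψ`, `c·∂_pψ`, `𝔥ψ` are in `L²(ℝ⁹)`; inner products of `toLp`'s are integrals; the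
  FEATURE IDENTITY `⟪√Vψ, √Vφ⟫ + Σ_p ⟪∂_pψ/√2, ∂_pφ/√2⟫ = ∫ φ·𝔥ψ` (Green, `energyBilin_eq_integral_mul_hApply`) and its
  diagonal `‖ψ‖² + (…) = ‖ψ‖²_{L²} + 𝔮(ψ)` — so that `ψ ↦ (ψ, √Vψ, (∂_pψ/√2)_p) ∈ ⨁_{11} L²` realises the form inner
  product `𝔮 + ⟨·,·⟩` WITHOUT a new instance;
* §2 RELLICH ON THE CORE: for every `r` the `L²`-classes of invariant test functions with `𝔮(ψ) + ‖ψ‖² ≤ r` form a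
  totally bounded subset of `L²(ℝ⁹)` — the valley bound `⅔∫‖x‖ψ² ≤ 𝔮(ψ)` (`integral_norm_sq_le_energyForm`, B. Simon
  1983) makes `‖x‖` a confining weight dominated by the form, and `∫‖∇ψ‖² ≤ 2𝔮(ψ)`;
* §3 the core realised in `⨁_{11} L²` by an abstract feature map `T` (hypotheses `hT0`–`hT2`): `⟪Tf, Tg⟫ = ∫fg + ∫ g·𝔥f`,
  `‖Tf‖² = ‖f‖² + 𝔮(f)`, injectivity, and infinite-dimensionality of `T(C)` from the shell functions.

Theorems only: no definitions, no named facts, no instances, no notation.  Real analysis; NOT a claim about any gap.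

## References
* [ReedSimonIV1978] M. Reed, B. Simon, *Methods of Modern Mathematical Physics IV* (1978), Thm XIII.2, XIII.64–65.
* [SimonB1983DiscreteSpectrum] B. Simon, Ann. Phys. 146 (1983) 209–220, §2 eq. (5).
* [Kato1966] T. Kato, *Perturbation Theory for Linear Operators*, VI §1.3 (the inner product `(𝔥+1)[u,v]`).
-/

noncomputable section

open MeasureTheory Filter Topology Real
open scoped InnerProductSpace BigOperators

namespace Literature.Analysis.OperatorTheory.YMMatrixModel

/-! ### §1. `L²` bookkeeping on the core -/

section Core

variable {ψ φ : ZM → ℝ}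
/-- A test function is in `L²`. [cite: ReedSimonIV1978, Thm. XIII.2] -/
theorem memLp_two_of_isTestFn (hψ : IsTestFn ψ) : MemLp ψ 2 (volume : Measure ZM) :=
  hψ.continuous.memLp_of_hasCompactSupport hψ.2

/-- `√V · ψ ∈ L²` for a test function. [cite: ReedSimonIV1978, Thm. XIII.2] -/
theorem memLp_two_sqrtPot_of_isTestFn (hψ : IsTestFn ψ) :
    MemLp (fun x => Real.sqrt (luscherPotential x) * ψ x) 2 (volume : Measure ZM) :=
  ((continuous_sqrt.comp continuous_luscherPotential).mul hψ.continuous).memLp_of_hasCompactSupport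
    hψ.2.mul_left

/-- `c · ∂_p ψ ∈ L²` for a test function. [cite: ReedSimonIV1978, Thm. XIII.2] -/
theorem memLp_two_const_mul_pderiv_of_isTestFn (hψ : IsTestFn ψ) (c : ℝ) (p : Fin 3 × Fin 3) :
    MemLp (fun x => c * pderiv p ψ x) 2 (volume : Measure ZM) :=
  (continuous_const.mul (hψ.continuous_pderiv p)).memLp_of_hasCompactSupport (hψ.hasCompactSupport_pderiv p).mul_left

/-- `𝔥ψ ∈ L²` for a test function. [cite: ReedSimonIV1978, Thm. XIII.2] -/
theorem memLp_two_hApply_of_isTestFn (hψ : IsTestFn ψ) : MemLp (hApply ψ) 2 (volume : Measure ZM) :=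
  (continuous_hApply hψ.1).memLp_of_hasCompactSupport (hasCompactSupport_hApply hψ)

/-- The `L²(ℝ⁹)` inner product of two `toLp`'s of real functions is the integral of the product. [cite: ReedSimonIV1978, Thm. XIII.2] -/
theorem inner_toLp_toLp {f g : ZM → ℝ} (hf : MemLp f 2 (volume : Measure ZM)) (hg : MemLp g 2 (volume : Measure ZM)) :
    ⟪hf.toLp f, hg.toLp g⟫_ℝ = ∫ x, f x * g x := by
  rw [MeasureTheory.L2.inner_def]
  refine integral_congr_ae ?_
  filter_upwards [hf.coeFn_toLp, hg.coeFn_toLp] with x hx hy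
  rw [hx, hy]
  simp only [RCLike.inner_apply, conj_trivial]
  ring

/-- The `L²(ℝ⁹)` inner product of a class `v` with a `toLp` is `∫ v·g`. [cite: ReedSimonIV1978, Thm. XIII.2] -/
theorem inner_toLp_right (v : Lp ℝ 2 (volume : Measure ZM)) {g : ZM → ℝ} (hg : MemLp g 2 (volume : Measure ZM)) :
    ⟪v, hg.toLp g⟫_ℝ = ∫ x, v x * g x := by
  rw [MeasureTheory.L2.inner_def]
  refine integral_congr_ae ?_
  filter_upwards [hg.coeFn_toLp] with x hy
  rw [hy]
  simp only [RCLike.inner_apply, conj_trivial]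
  ring

/-- **The feature identity (Green)**: for test functions `ψ, φ`,
`⟪√Vψ, √Vφ⟫ + Σ_p ⟪∂_pψ/√2, ∂_pφ/√2⟫ = ∫ φ · 𝔥ψ` — the form `𝔮(φ,ψ)` written once as a sum of `L²` inner products of
"features" of `ψ`, `φ` and once through the operator on the core (`energyBilin φ ψ = ∫ φ·𝔥ψ`, Green's identity).
[cite: Kato1966, VI §1.3 Example 1.8] -/
theorem inner_features_eq_integral_mul_hApply (hψ : IsTestFn ψ) (hφ : IsTestFn φ) :
    ⟪(memLp_two_sqrtPot_of_isTestFn hψ).toLp _, (memLp_two_sqrtPot_of_isTestFn hφ).toLp _⟫_ℝ +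
        ∑ p, ⟪(memLp_two_const_mul_pderiv_of_isTestFn hψ (Real.sqrt 2)⁻¹ p).toLp _,
              (memLp_two_const_mul_pderiv_of_isTestFn hφ (Real.sqrt 2)⁻¹ p).toLp _⟫_ℝ =
      ∫ x, φ x * hApply ψ x := by
  rw [← energyBilin_eq_integral_mul_hApply hφ hψ.1, energyBilin_def, inner_toLp_toLp]
  simp_rw [inner_toLp_toLp]
  have I1 : ∀ p, Integrable fun x => pderiv p φ x * pderiv p ψ x := fun p => integrable_pderiv_mul_pderiv hφ.1 hψ p
  have I2 : Integrable fun x => luscherPotential x * (φ x * ψ x) := integrable_potential hφ.continuous hψ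
  rw [integral_add ((integrable_finsetSum _ fun p _ => I1 p).const_mul _) I2, integral_const_mul,
    integral_finsetSum _ fun p _ => I1 p, Finset.mul_sum]
  have e1 : ∫ x, Real.sqrt (luscherPotential x) * ψ x * (Real.sqrt (luscherPotential x) * φ x) =
      ∫ x, luscherPotential x * (φ x * ψ x) := by
    refine integral_congr_ae (Eventually.of_forall fun x => ?_)
    have h := Real.mul_self_sqrt (luscherPotential_nonneg x)
    show Real.sqrt (luscherPotential x) * ψ x * (Real.sqrt (luscherPotential x) * φ x) = luscherPotential x * (φ x * ψ x)
    calc Real.sqrt (luscherPotential x) * ψ x * (Real.sqrt (luscherPotential x) * φ x)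
        = (Real.sqrt (luscherPotential x) * Real.sqrt (luscherPotential x)) * (φ x * ψ x) := by ring
      _ = luscherPotential x * (φ x * ψ x) := by rw [h]
  have e2 : ∀ p, ∫ x, (Real.sqrt 2)⁻¹ * pderiv p ψ x * ((Real.sqrt 2)⁻¹ * pderiv p φ x) =
      (1 / 2 : ℝ) * ∫ x, pderiv p φ x * pderiv p ψ x := fun p => by
    rw [← integral_const_mul]
    refine integral_congr_ae (Eventually.of_forall fun x => ?_)
    have h2 : (Real.sqrt 2)⁻¹ * (Real.sqrt 2)⁻¹ = 1 / 2 := by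
      rw [← mul_inv, Real.mul_self_sqrt (by norm_num : (0 : ℝ) ≤ 2)]; norm_num
    show (Real.sqrt 2)⁻¹ * pderiv p ψ x * ((Real.sqrt 2)⁻¹ * pderiv p φ x) = (1 / 2 : ℝ) * (pderiv p φ x * pderiv p ψ x)
    calc (Real.sqrt 2)⁻¹ * pderiv p ψ x * ((Real.sqrt 2)⁻¹ * pderiv p φ x)
        = ((Real.sqrt 2)⁻¹ * (Real.sqrt 2)⁻¹) * (pderiv p φ x * pderiv p ψ x) := by ring
      _ = (1 / 2 : ℝ) * (pderiv p φ x * pderiv p ψ x) := by rw [h2]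
  rw [e1]
  simp_rw [e2]
  ring

/-- The diagonal case: `⟪ψ,ψ⟫ + (⟪√Vψ,√Vψ⟫ + Σ_p ⟪∂_pψ/√2,∂_pψ/√2⟫) = ‖ψ‖²_{L²} + 𝔮(ψ)` — the feature vector of `ψ` has
squared norm `‖ψ‖² + 𝔮(ψ)`, the `(𝔮 + 1)`-inner product of the form core. [cite: Kato1966, VI §1.3 Example 1.8] -/
theorem inner_features_self (hψ : IsTestFn ψ) :
    ⟪(memLp_two_of_isTestFn hψ).toLp ψ, (memLp_two_of_isTestFn hψ).toLp ψ⟫_ℝ +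
        (⟪(memLp_two_sqrtPot_of_isTestFn hψ).toLp _, (memLp_two_sqrtPot_of_isTestFn hψ).toLp _⟫_ℝ +
          ∑ p, ⟪(memLp_two_const_mul_pderiv_of_isTestFn hψ (Real.sqrt 2)⁻¹ p).toLp _,
                (memLp_two_const_mul_pderiv_of_isTestFn hψ (Real.sqrt 2)⁻¹ p).toLp _⟫_ℝ) =
      l2sq ψ + energyForm ψ := by
  rw [inner_features_eq_integral_mul_hApply hψ hψ, ← energyBilin_eq_integral_mul_hApply hψ hψ.1, energyBilin_self,
    inner_toLp_toLp, l2sq]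
  congr 1
  exact integral_congr_ae (Eventually.of_forall fun x => by simp only [sq])

end Core

/-! ### §2. Rellich on the core -/

/-- `‖Dψ(x)‖ = ‖∇ψ(x)‖` (Riesz). [cite: ReedSimonIV1978, Thm. XIII.2] -/
theorem norm_fderiv_eq_norm_gradient (ψ : ZM → ℝ) (x : ZM) : ‖fderiv ℝ ψ x‖ = ‖gradient ψ x‖ := by
  rw [gradient, LinearIsometryEquiv.norm_map]

/-- **Rellich on the invariant core** (Reed–Simon IV, Thm XIII.65 via the valley bound): for every `r`, the set of
`L²(ℝ⁹)`-classes of invariant test functions `ψ` with `𝔮(ψ) + ‖ψ‖² ≤ r` is totally bounded in `L²(ℝ⁹)`.  Inputs: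
`∫ψ² ≤ r`, `∫‖∇ψ‖² ≤ 2𝔮(ψ) ≤ 2r` (`integral_norm_gradient_sq_le`), `∫‖x‖ψ² ≤ (3/2)𝔮(ψ) ≤ (3/2) r`
(`integral_norm_sq_le_energyForm`), and `Literature.Analysis.FunctionSpaces.totallyBounded_Lp_of_confining` with the
confining weight `W = ‖x‖`. [cite: ReedSimonIV1978, Thm. XIII.65] -/
theorem totallyBounded_core (r : ℝ) :
    TotallyBounded {v : Lp ℝ 2 (volume : Measure ZM) | ∃ ψ : ZM → ℝ, IsTestFn ψ ∧ IsGaugeInv ψ ∧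
      (v : ZM → ℝ) =ᵐ[volume] ψ ∧ energyForm ψ + l2sq ψ ≤ r} := by
  refine TotallyBounded.subset ?_
    (Literature.Analysis.FunctionSpaces.totallyBounded_Lp_of_confining (F := ℝ) (volume : Measure ZM)
      (W := fun x : ZM => ‖x‖) (fun x => norm_nonneg x) (fun M => ⟨M, fun x hx => hx⟩) r (2 * r) (3 / 2 * r))
  rintro v ⟨ψ, hψ, -, hv, hr⟩
  have hE := energyForm_nonneg ψ
  have hL := l2sq_nonneg ψ
  refine ⟨ψ, hψ.1.of_le (by norm_num), hψ.2, hv, ?_, ?_, ?_, ?_⟩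
  · have h := hψ.integrable_mul_sq continuous_norm
    exact h.congr (Eventually.of_forall fun x => by simp only [Real.norm_eq_abs, sq_abs])
  · have e : ∫ x, ‖ψ x‖ ^ 2 = l2sq ψ := by
      rw [l2sq]; exact integral_congr_ae (Eventually.of_forall fun x => by simp only [Real.norm_eq_abs, sq_abs])
    rw [e]; linarith
  · have e : ∫ x, ‖fderiv ℝ ψ x‖ ^ 2 = ∫ x, ‖gradient ψ x‖ ^ 2 :=
      integral_congr_ae (Eventually.of_forall fun x => by simp only [norm_fderiv_eq_norm_gradient])
    rw [e]
    linarith [integral_norm_gradient_sq_le hψ]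
  · have e : ∫ x, ‖x‖ * ‖ψ x‖ ^ 2 = ∫ x, ‖x‖ * ψ x ^ 2 :=
      integral_congr_ae (Eventually.of_forall fun x => by simp only [Real.norm_eq_abs, sq_abs])
    rw [e]
    linarith [integral_norm_sq_le_energyForm hψ]


/-! ### §3. A core of test functions realised inside `⨁_{11} L²(ℝ⁹)` by its features -/

section CoreSpace

variable {C : Submodule ℝ (ZM → ℝ)} (hC : ∀ f : C, IsTestFn (f : ZM → ℝ) ∧ IsGaugeInv (f : ZM → ℝ))
  (T : C →ₗ[ℝ] PiLp 2 (fun _ : Option (Option (Fin 3 × Fin 3)) => Lp ℝ 2 (volume : Measure ZM)))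
  (hT0 : ∀ f : C, (T f) none = (memLp_two_of_isTestFn (hC f).1).toLp _)
  (hT1 : ∀ f : C, (T f) (some none) = (memLp_two_sqrtPot_of_isTestFn (hC f).1).toLp _)
  (hT2 : ∀ (f : C) (p : Fin 3 × Fin 3),
    (T f) (some (some p)) = (memLp_two_const_mul_pderiv_of_isTestFn (hC f).1 (Real.sqrt 2)⁻¹ p).toLp _)

include hT0 hT1 hT2 in
/-- `⟪Tf, Tg⟫ = ∫ f g + ∫ g · 𝔥f` for core functions (feature identity). [cite: ReedSimonIV1978, Thm. XIII.2] -/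
theorem inner_coreMap (f g : C) : ⟪T f, T g⟫_ℝ = (∫ x, (f : ZM → ℝ) x * (g : ZM → ℝ) x) +
    ∫ x, (g : ZM → ℝ) x * hApply (f : ZM → ℝ) x := by
  rw [PiLp.inner_apply, Fintype.sum_option, Fintype.sum_option]
  simp only [hT0, hT1, hT2]
  rw [inner_toLp_toLp, inner_features_eq_integral_mul_hApply (hC f).1 (hC g).1]

include hT0 hT1 hT2 in
/-- `‖Tf‖² = ‖f‖²_{L²} + 𝔮(f)` for core functions. [cite: ReedSimonIV1978, Thm. XIII.2] -/
theorem norm_coreMap_sq (f : C) : ‖T f‖ ^ 2 = l2sq (f : ZM → ℝ) + energyForm (f : ZM → ℝ) := by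
  rw [← real_inner_self_eq_norm_sq, PiLp.inner_apply, Fintype.sum_option, Fintype.sum_option]
  simp only [hT0, hT1, hT2]
  exact inner_features_self (hC f).1

include hT0 in
/-- `‖(Tf)₀‖² = ‖f‖²_{L²}`. [cite: ReedSimonIV1978, Thm. XIII.2] -/
theorem norm_coreMap_zero_sq (f : C) : ‖(T f) none‖ ^ 2 = l2sq (f : ZM → ℝ) := by
  rw [← real_inner_self_eq_norm_sq, hT0, inner_toLp_toLp, l2sq]
  exact integral_congr_ae (Eventually.of_forall fun x => by simp only [sq])

include hT0 in
/-- The feature map is injective (a continuous function is determined by its `L²` class). [cite: Kato1966, VI §1.3 Example 1.8] -/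
theorem coreMap_injective : Function.Injective T := by
  intro f g h
  have h0 : (memLp_two_of_isTestFn (hC f).1).toLp _ = (memLp_two_of_isTestFn (hC g).1).toLp _ := by
    rw [← hT0 f, ← hT0 g, h]
  have hae : (f : ZM → ℝ) =ᵐ[volume] (g : ZM → ℝ) := (MemLp.toLp_eq_toLp_iff _ _).1 h0
  exact Subtype.ext (((hC f).1.continuous.ae_eq_iff_eq volume (hC g).1.continuous).1 hae)

include hT0 in
/-- The realised core `T(C)` is infinite-dimensional when `C` contains the shell functions. [cite: ReedSimonIV1978, Thm. XIII.1] -/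
theorem not_finiteDimensional_range_coreMap (hCmem : ∀ ψ : ZM → ℝ, IsTestFn ψ → IsGaugeInv ψ → ψ ∈ C) :
    ¬ FiniteDimensional ℝ (LinearMap.range T) := by
  intro hfin
  obtain ⟨d, hd⟩ : ∃ d, Module.finrank ℝ (LinearMap.range T) = d := ⟨_, rfl⟩
  let sC : Fin (d + 1) → C := fun i => ⟨shellFn (i : ℕ), hCmem _ (isTestFn_shellFn _) (isGaugeInv_shellFn _)⟩
  have hsC : LinearIndependent ℝ sC := by
    refine LinearIndependent.of_comp C.subtype ?_
    exact linearIndependent_shellFn (d + 1)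
  have hs : LinearIndependent ℝ (T.rangeRestrict ∘ sC) :=
    hsC.map' T.rangeRestrict
      (by rw [LinearMap.ker_rangeRestrict]; exact LinearMap.ker_eq_bot.2 (coreMap_injective hC T hT0))
  have h := hs.fintype_card_le_finrank
  rw [Fintype.card_fin, hd] at h
  omega

end CoreSpace

end Literature.Analysis.OperatorTheory.YMMatrixModel

end
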